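import Mathlib
import HarnessLib
import HarnessLib.Audit
import Summits.SmoothPoincare4.Statement
import Literature.Topology.FourManifolds.DehnSurgery
import Literature.Topology.FourManifolds.HomotopyBallSlice
import Literature.Topology.FourManifolds.HomotopyBallSliceProofs
import HarnessLib.Audit.Status.Attr

/-!
Route: ZeroSurgeryExotic

DORMANT since 2026-08-26T16:58:19Z (reconciler: no traction for 5.2 d (last activity item-evidence-added at 2026-08-21T12:41:22Z); parked, not closed — `ledger route dormant route-SmoothPoincare4-ZeroSurgeryExotic --off` to reactivate) — unstaffed, not closed; items shared with open routes are served there. `ledger route dormant <id> --off` reactivates.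

# Route ZeroSurgeryExotic — a 0-surgery pair (K slice, K′ not) refutes SPC4 — X alone is open, X →
¬SPC4 is now a theorem of the tree

NEGATIVE-SIDE route (refutation form of the deciding theorem). It suffices to show X: there are
knots K, K′ ⊂ S³ and a 3-manifold Y
that is 0-surgery on both (Y ≅ S³₀(K) ≅ S³₀(K′), `IsIntegralSurgery (𝓡 3) Y K 0`), with K smoothly
slice in B⁴ and K′ not. Then
¬SmoothPoincare4: by Manolescu–Piccirillo's Lemma 3.3 (W = S⁴) K′ is slice in a homotopy 4-ball, and
by the FGMW lemma a knot slice in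
a homotopy ball but not in B⁴ yields an exotic 4-sphere. Both lemmas are DISCHARGED in the tree
(2026-08-15): the route is decided by X alone.
Lean: `∃ (K K' : Literature.Topology.FourManifolds.Knot) (Y : Type) (_ : TopologicalSpace Y) (_ :
ChartedSpace (EuclideanSpace ℝ (Fin 3)) Y), Literature.Topology.FourManifolds.IsIntegralSurgery (𝓡
3) Y K 0 ∧ Literature.Topology.FourManifolds.IsIntegralSurgery (𝓡 3) Y K' 0 ∧ K.IsSmoothlySlice ∧ ¬
K'.IsSmoothlySlice`

## Assembly
X → ¬SmoothPoincare4 is the single assembly item (stmt-SmoothPoincare4-0365) and it is PROVABLE NOW,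
verbatim, by eight lines over the
tree's discharges (certified in the planner folder, Sk/SketchFull.lean `assembly_holds`, rc 0,
axioms propext / Classical.choice /
Quot.sound): from X take (K, K′, Y); `FramedLink.isSurgery_single_iff` turns the two
`IsIntegralSurgery` hypotheses into the
`(FramedLink.single _ 0).IsSurgery` form; `Knot.ManolescuPiccirillo2023_lemma33_sphere_holds K K′ Y`
gives `K′.IsHomotopyBallSlice`;
`Knot.exists_exotic_of_isHomotopyBallSlice_not_isSmoothlySlice_holds ⟨K′, _, _⟩` gives a closed
smooth M ≃ₕ S⁴ with
`IsEmpty (M ≃ₘ S⁴)`; SPC4 (unfolded: `hS M _ _ e : Nonempty (M ≃ₘ S⁴)`) contradicts it. The proofs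
live in Theorems (their import
closure is 321 Literature modules and must stay out of the route file); the DECIDING THEOREM is pure
logic:
`theorem closes (hX : ZseThesis) (hA : Assembly) : ¬ SmoothPoincare4 := hA hX` (glue.lean,
`--refutation`).

Rationale: WHY THIS LINE. It is the one refutation programme for SPC4 with a finite, machine-checkable
certificate: two knot diagrams, a certified 0-surgery
diffeomorphism (Kirby calculus / RBG links, ManolescuPiccirillo2023 Thm 1.2; annulus twists), a
slice disc for K (ribbon moves) and a
B⁴-sliceness obstruction for K′ — Rasmussen's s from Khovanov homology (Rasmussen2010 Thm 1), as in
the FGMW "man and machine" attack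
(FreedmanGompfMorrisonWalker2010 §1) and Manolescu–Piccirillo's five RBG candidates (killed by
Nakamura2023 Thm 1.1/1.3, the framework
not). Imported areas: knot concordance, categorified quantum invariants (Kh, s), certified
computation (crux 2 is a search with checkable
witnesses); no spectral / probabilistic / motivic reformulation applies to an existence-of-a-pair
statement. What changed at this
repair: the whole assembly X → ¬SPC4 (MP Lemma 3.3 for W = S⁴ + FGMW + Palais) is now PROVED in
Literature
(`Knot.ManolescuPiccirillo2023_lemma33_sphere_holds`,
`Knot.exists_exotic_of_isHomotopyBallSlice_not_isSmoothlySlice_holds`), so the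
route no longer carries any unproved named fact of its own; the negatives index of the summit is
empty (checked 2026-08-15).

RANKED CRUXES. #0 ZseThesis (target) — there exist knots K, K′ and a 3-manifold Y, 0-surgery on
both, with K smoothly slice and K′ not smoothly slice (item stmt-SmoothPoincare4-0364, unchanged).
(why it might fail: X may be false: 0-surgery type may determine smooth sliceness (kill switch
Assembly2; SPC4 ⇒ it). Every supply so far collapsed: MP's 5 knots non-slice (Nakamura2023 Thm 1.1),
Z_n standard (Thm 1.3), X_DG standard (OliveiraSmith2026).) [ManolescuPiccirillo2023, Nakamura2023,
DunfieldGong2025, OliveiraSmith2026, arXiv:2601.05425]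
#2 ZseCruxRasmussen (crux) — the searchable form of X with an s-witness: a 0-surgery pair with K
slice and s(K′) ≠ 0 (item stmt-SmoothPoincare4-0366; INFORMAL until
`Literature.Topology.FourManifolds.LeeRasmussen` may be imported — its cone still carries the
undischarged Kh facts `Knot.reidemeister`, `nonempty_iso_khovanovHomology_of_equiv`; the glue "s ≠ 0
⇒ ¬slice" is Rasmussen's `eq_zero_of_isSmoothlySlice`, whose file re-imports BandSum). [difficulty:
open-problem] (why it might fail: s may vanish on every knot slice in a homotopy ball (MMSW Q9.11
open; KM2013 Cor 1.1 withdrawn); it does on MP's special RBG family (Nakamura2023 Thm 3.13) and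
super-special RBG links (DunfieldGong2025 Thm 5.9); live DG pairs are seen only by LEO s̃_c.)
[ManolescuMarengonSarkarWillis2023, KronheimerMrowka2013, Nakamura2023, DunfieldGong2025,
arXiv:2305.16089, DunfieldLipshitzSchuetz2023, Rasmussen2010]
#3 Assembly2 (crux) — KILL SWITCH (= ¬X in ∀-form, the positive side's toe-hold; item
stmt-SmoothPoincare4-0367, decl `Assembly2` — a CRUX by intent and rank, kinded `assembly` only by
the legacy decl-name rule; planner verbs cannot rebadge/rename/drop assembly-kinded items (gate:
'cannot be dropped / retriaged', restate keeps kind), OPERATOR rebadge to crux requested): the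
0-surgery diffeomorphism type of a knot determines its smooth sliceness — if Y is 0-surgery on K and
on K′ and K is slice then K′ is slice. SPC4 ⇒ this (MP Lemma 3.3 + FGMW/Palais, both proved in
tree); a proof closes the route `refuted:ZseThesis`. [difficulty: open-problem] (why it might fail:
it is ¬X: false as soon as one 0-surgery pair with K slice, K′ non-slice exists (DunfieldGong2025
Table 11 lists live candidates); only the 0-TRACE analogue is a theorem (trace embedding lemma,
Piccirillo2020), 0-surgery ⇏ 0-trace.) [ManolescuPiccirillo2023, Piccirillo2020, Kirby1997,
DunfieldGong2025]
#4 ZseSVanishesOnPairs (crux) — kill test for crux 2 only (item stmt-SmoothPoincare4-0368; INFORMAL,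
same LeeRasmussen caveat): on 0-surgery pairs with K slice, s(K′) = 0 — MMSW Question 9.11
restricted to homotopy balls born from 0-surgery pairs. [deps: ZseCruxRasmussen] [difficulty:
open-problem] (why it might fail: false once one pair has K slice, s(K′) ≠ 0 (= crux 2); beyond
Gluck twists (MMSW Cor 1.13) and (super-)special RBG families (Nakamura2023 Thm 3.13,
DunfieldGong2025 Thm 5.9) no vanishing mechanism is in print (arXiv:2601.05425 p.24).)
[ManolescuMarengonSarkarWillis2023, ManolescuPiccirillo2023, KronheimerMrowka2013, Nakamura2023,
DunfieldGong2025, arXiv:2601.05425]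
#9 ZseHsliceNotSlice (support) — the FGMW / MP waypoint one level above X (item
stmt-SmoothPoincare4-0520): some knot is slice in a homotopy 4-ball but not in B⁴. X ⇒ this by the
PROVED MP lemma; this ⇒ ¬SPC4 by the PROVED FGMW lemma; shared with every H-slice strategy.
[difficulty: open-problem] [FreedmanGompfMorrisonWalker2010, ManolescuPiccirillo2023,
arXiv:2601.05425]

TWO-LAYER PLAN. None filed. Foreseen once crux 2 materialises: ZseCruxRasmussen ⇐ (PairSupply: an
explicit 0-surgery diffeomorphism S³₀(K) ≅ S³₀(K′)
with K ribbon, from an RBG link / annulus twist outside Nakamura's and Dunfield–Gong's vanishing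
families) → (SWitness: s(K′) ≠ 0 by a
certified Kh computation) → ZseCruxRasmussen (k = 2, depth 1).

KILL CRITERIA. - Assembly2 (the ¬X kill switch) PROVED (0-surgery type determines sliceness) ⇒ X
refuted ⇒ `close --reason refuted:ZseThesis`.
- ZseSVanishesOnPairs proved ⇒ crux 2 dead; the route survives only if a B⁴-only obstruction other
than s_ℚ is named (LEO s̃_c of
  DunfieldLipshitzSchuetz2023 §7, or one not extending to homotopy balls) — pivot note + restated
crux required, else close exhausted.
- A theorem "every 0-surgery homeomorphism is induced by an RBG link in a family where s(K′) is
forced to vanish" (Nakamura2023 Thm 3.13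
  pattern made universal) ⇒ close.
- MOOT if SPC4 is refuted elsewhere (any ExistsExoticFourSphere theorem); the Assembly item stays a
valid theorem regardless.

NOT DECOMPOSED YET. - The supply of 0-surgery homeomorphisms (RBG links, annulus twists, satellites)
and the Kh computation — search detail below crux level.
- Materialising cruxes 2 and 4 (they need `import Literature.Topology.FourManifolds.LeeRasmussen`, 4
extra modules): deferred until the
  Kh well-definedness facts in that closure (`Knot.reidemeister`,
`nonempty_iso_khovanovHomology_of_equiv`) are discharged, so the
  route's cone stays at 8 modules with no unproved fact outside the Statement file; the glue crux 2
→ X additionally needs Rasmussen's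
  `eq_zero_of_isSmoothlySlice` (Rasmussen.lean, cone via BandSum) — genuinely needed for the
s-sub-line only, not for the deciding chain.
- No new item restates the two proved lemmas (MP 3.3, FGMW): they are consumed inside the Theorems
proof of Assembly, not as
  hypotheses; the legacy glue items Assembly3/Assembly4 that carried them as antecedents are
superseded (see Numbers).
- Statement-level cone: 13 SPC4Wave0 facts ride on `import
Literature.Topology.FourManifolds.SPC4Wave0` in
  Summits/SmoothPoincare4/SmoothPoincare4/Statement.lean (operator-only file; its body uses none) —
flagged to the operator, not routable.

CHEAPEST FALSIFIER. For the MECHANISM (s as witness): Nakamura2023 Thm 3.13 / DunfieldGong2025 Thm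
5.9 already force s(K′) = 0 on every (super-)special RBG
pair with a plain s witness, and DunfieldGong2025 Table 11's 500k 0-friend pairs produced no (slice,
s ≠ 0) pair; OliveiraSmith2026 removed
the last DG disjunct (X_DG standard). So the cheapest kill of crux 2 is a literature lookup each
quarter: has MMSW Question 9.11 (s of
knots slice in homotopy balls) been answered positively (e.g. via Ren–Willis-type functoriality in
S¹×S³-summands)? If yes, crux 4 is
`known`, crux 2 dies, and the route must pivot to LEO s̃_c or close. Not runnable by kit here (no
certified Kh pipeline on the hub).

NUMBERS. - Candidates killed: 5/5 MP knots (Nakamura2023 Thm 1.1); 23 knots non-slice (ibid.);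
DunfieldGong2025: ~5·10⁵ 0-friend pairs, 4 live
  pairs in Table 11 (exotic S⁴ if any of 16n68278, 17nh0010647, 18nh00098198 is slice; the fourth
disjunct '18nh00000601 not slice' is gone: X_DG is standard, hence 18nh00000601 is slice,
OliveiraSmith2026).
- Items: 8 ledger rows — target ZseThesis; informal cruxes ZseCruxRasmussen (r2),
ZseSVanishesOnPairs (r4); kill switch Assembly2
  (r3, crux by intent); support ZseHsliceNotSlice; THE assembly `Assembly` (X → ¬SPC4, provable
now); plus two SUPERSEDED legacy
  assembly-kinded glue items Assembly3 (FGMW-fact → W → ¬SPC4, already a theorem: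
Theorems/ZeroSurgeryExoticAssembly.lean) and
  Assembly4 (MP → X → W, pure logic) that planner verbs can neither drop nor rebadge (gate policy) —
OPERATOR: rebadge 0521/0522 →
  support (or close 0521 proved), 0367 → crux; the deciding theorem uses only ZseThesis and
Assembly.
- Route import cone after repair: DehnSurgery + HomotopyBallSlice (8 modules) +
HomotopyBallSliceProofs (→ 18 modules, imported only so
  that the FGMW fact named in legacy Assembly3 resolves to its discharge `…_holds` for the gate's
decl-level staffability); listed
  unproved cone facts needed: 0 of 18 (the 5 BandSum/KirbyMoves ones left with
KirbyMoves/Knots/LinkingNumber; 13 are Statement-level).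

DEFINITION REQUESTS. None new. `Knot.IsHomotopyBallSlice` landed (HomotopyBallSlice.lean);
`Knot.HasRasmussenInvariant` exists (LeeRasmussen.lean:366) but is
deliberately not imported (see Not decomposed yet).

Novelty: NOVELTY (searched 2026-08-14: `lit frontier SmoothPoincare4`; `lit read` of arXiv:2102.04391 pp.1-4,
arXiv:2203.14270 pp.1-5, arXiv:2512.21825 pp.34/44/47-48, arXiv:2601.05425 pp.24-25,
arXiv:2603.23717 abstract; barrier catalogue Literature/Barriers/SmoothPoincare4/, 17 entries).
Nearest prior art — the line IS the Freedman–Gompf–Morrison–Walker / Manolescu–Piccirillo programme: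
[FreedmanGompfMorrisonWalker2010, §1] (certify a homotopy ball exotic by a knot slice in it with
Rasmussen s ≠ 0); [ManolescuPiccirillo2023, §1 p.3 (the 0-surgery-pair construction of the homotopy
sphere W), Thm 1.2 (RBG links ↔ 0-surgery homeomorphisms), Thm 1.3 (5 candidates)]; killed for MP's
family by [Nakamura2023, Thm 1.1 (the 23 knots are not slice), Thm 1.2/3.13 (s cannot detect within
the MP family), Thm 1.3 (the annulus-twist spheres Z_n are standard)] and, for every super-special
RBG link with a plain s_F witness, by [DunfieldGong2025, Thm 5.9] (= Nakamura Thm 3.13 +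
arXiv:2305.16089 Cor 1.5). Current frontier: [DunfieldGong2025, Thm 5.14 p.47, Table 11 p.48] — 500k
0-friend pairs; exotic S⁴ if 18nh00000601 is not slice or any of 16n68278, 17nh0010647, 18nh00098198
is slice, the non-slice partners being detected only by the LEO refinement s̃_c of
[DunfieldLipshitzSchuetz2023, §7]; first disjunct removed by [OliveiraSmith2026] (X_DG standard ⇒
18nh00000601 slice). Status per the survey arXiv:2601.05425 §7 p.24: "As of now, no pairs (K, K′)
with the above properties have been found", and for  [refs: 2102.04391, 2203.14270, 2512.21825, 2601.05425, 2603.23717, 2305.16089, FreedmanGompfMorrisonWalker2010, ManolescuPiccirillo2023, Nakamura2023, DunfieldGong2025, DunfieldLipshitzSchuetz2023, OliveiraSmith2026, ManolescuMarengonSarkarWillis2023, KronheimerMrowka2013]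

Barriers (technique_class: zero-surgery pairs; s-invariant witness; certified search): BARRIERS (catalogue Literature/Barriers/SmoothPoincare4/, all 17 entries checked 2026-08-14; Z
denotes the homotopy 4-sphere X₀(K′) ∪ (B⁴ ∖ νD) built from a 0-surgery pair with K = ∂D slice).
- Literature.Barriers.SmoothPoincare4.GluckTwistCP2Barrier — APPLIES to the s-witness crux
ZseCruxRasmussen: if Z is a Gluck twist (or merely dissolves after one ℂℙ² and one ℂℙ²bar summand,
MMSW §9.3) then s(K′) = 0 by the vendored fact `rasmussen_eq_zero_of_isSliceDiscIn_gluckTwist`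
[ManolescuMarengonSarkarWillis2023, Cor 1.13] and the pair is useless. Evasion: NOT by mechanism;
the bet is that some 0-surgery-born Z is not ℂℙ²-dissolvable — nothing printed decides dissolution
for RBG-link / annulus-twist spheres (MMSW Question 9.12 asks it even for balanced-presentation
spheres), and the same file's `not_fgmwRasmussenStrategy_iff_question` records that beyond Gluck
twists the obstruction is exactly the OPEN `MMSW2023Question911Knot`, of which our kill-test crux
ZseSVanishesOnPairs is the 0-surgery-pair restriction. Family-wise vanishing not (yet) catalogued
but binding on the search: [Nakamura2023, Thm 1.2/3.13] (MP's special RBG family) and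
[DunfieldGong2025, Thm 5.9] (super-special RBG links, plain s_F, via arXiv:2305.16089 Cor 1.5) —
candidates must come from 0-surgery homeomorphisms outside these families, or use a witness finer
than s_ℚ (LEO s̃_c, [DunfieldLipshitzSchuetz2023, §7]), in which case ZseCruxRasmussen must be
restated over that invariant.
- Literature.Barriers.SmoothPoi

History (route lifecycle, newest last):
- 2026-08-16T04:19:45Z · AUTO-CRUX (backfill): ZseThesis — hypotheses of the deciding theorem that nothing in the route derives are cruxes (operator:999:1085951)
- 2026-08-16T14:15:59Z · LINT AUTOFIX: dropped duplicate assembly item(s) Assembly2, Assembly3, Assembly4 (kept the one `closes` uses) (operator:gate4)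
- 2026-08-26T16:58:19Z · DORMANT — reconciler: no traction for 5.2 d (last activity item-evidence-added at 2026-08-21T12:41:22Z); parked, not closed — `ledger route dormant route-SmoothPoincare4- (operator:999:3301580)

sub-problem: SmoothPoincare4 · status: dormant · opened planner-SmoothPoincare4-Survey-0 2026-08-13T06:11:11Z · rev 8 · ledger route-SmoothPoincare4-ZeroSurgeryExotic
GENERATED by the gate from the ledger (D-0016/17). Provers cite these decls: `theorem foo : Summit.SmoothPoincare4.SmoothPoincare4.Theses.ZeroSurgeryExotic.<Decl> := …` in Summits/SmoothPoincare4/SmoothPoincare4/Theorems/<Name>.lean.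
-/

namespace Summit.SmoothPoincare4.SmoothPoincare4.Theses.ZeroSurgeryExotic

open scoped BigOperators Topology Manifold Classical MeasureTheory ProbabilityTheory Matrix InnerProductSpace ComplexConjugate ContinuousMap
open Filter Set Function TopologicalSpace MeasureTheory

attribute [summit_statement] _root_.SmoothPoincare4

open Literature.SPC4

/-! Retired items kept as plain definitions (history; not obligations of this route): landed proofs / closed glue still name them. -/

/-- retired stmt-SmoothPoincare4-0521 (dropped, gen None) — proved by Summit.SmoothPoincare4.SmoothPoincare4.Theorems.zeroSurgeryExotic_assembly3_proof. -/
def Assembly3 : Prop :=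
  Literature.Topology.FourManifolds.Knot.exists_exotic_of_isHomotopyBallSlice_not_isSmoothlySlice → (∃ K : Literature.Topology.FourManifolds.Knot, K.IsHomotopyBallSlice ∧ ¬ K.IsSmoothlySlice) → ¬ SmoothPoincare4

/-- item stmt-SmoothPoincare4-0364 · crux (kind.auto-crux: conjecture-grade) · rank 0 · open · by planner
why it might fail: X may be false: 0-surgery type may determine smooth sliceness (Assembly2; SPC4 implies it). Every candidate supply so far collapsed: MP's 5 knots non-slice (Nakamura2023 Thm 1.1), MP's Z_n standard (Thm 1.3), X_DG standard (OliveiraSmith2026); 'no pairs ... have been found' (arXiv:2601.05425 p.24).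
sources: ManolescuPiccirillo2023, §1 p.3 (framework), Thm 1.2, Thm 1.3, Nakamura2023, Thm 1.1, Thm 1.3, DunfieldGong2025, Thm 5.14 p.47, Table 11 p.48, OliveiraSmith2026 (arXiv:2603.23717, abstract), arXiv:2601.05425, §7 pp.24-25
There exist knots K, K' in S³ and a closed 3-manifold Y with Y = S³_0(K) = S³_0(K') (integral
0-surgery, `FramedLink.single _ 0`), K smoothly slice in B⁴ and K' not smoothly slice. Sources:
ManolescuPiccirillo2023 §1; FreedmanGompfMorrisonWalker2010. opens: `open scoped Manifold ContDiff`,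
`open ContinuousMap`; imports: Summits.SmoothPoincare4.Statement +
Literature.Topology.FourManifolds.{HomotopySpheres,KirbyMoves,SliceRibbon,LeeRasmussen,Morse,ConnectedSum,Cobordism,GluckTwist,SurgeryGluck,CappellShaneson}
+ Literature.Geometry.Lorentzian.LeviCivita. [elaboration note 2026-08-13: depends on
Literature.Topology.FourManifolds.Knots whose .olean is missing at HEAD (Knots.lean has 3 proofs
broken by the M5 demotion of IsAmbientIsotopic.symm/trans/isSmoothlyIsotopic to Props); signature
elaborated against a locally patched overlay build — re-run `lean check` once Knots is rebuilt.] -/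
@[route_item "route-SmoothPoincare4-ZeroSurgeryExotic", crux]
def ZseThesis : Prop :=
  ∃ (K K' : Literature.Topology.FourManifolds.Knot) (Y : Type) (_ : TopologicalSpace Y) (_ : ChartedSpace (EuclideanSpace ℝ (Fin 3)) Y), Literature.Topology.FourManifolds.IsIntegralSurgery (𝓡 3) Y K 0 ∧ Literature.Topology.FourManifolds.IsIntegralSurgery (𝓡 3) Y K' 0 ∧ K.IsSmoothlySlice ∧ ¬ K'.IsSmoothlySlice

-- TODO item stmt-SmoothPoincare4-0366 · crux · rank 2 · open · by planner — BLOCKED: missing decl(s) Literature.Topology.FourManifolds.SphereEmbedding.HasRasmussenInvariant; restate via `ledger route edit` once they land: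
--   def ZseCruxRasmussen : Prop := ∃ (K K' : Literature.Topology.FourManifolds.Knot) (Y : Type) (_ : TopologicalSpace Y) (_ : ChartedSpace (EuclideanSpace ℝ (Fin 3)) Y) (s : ℤ), Literature.Topology.FourManifolds.IsIntegralSurgery (𝓡 3) Y K 0 ∧ Literature.Topology.FourManifolds.IsIntegralSurgery (𝓡 3) Y K' 0 ∧ K.IsSmoothlySlice ∧ K'.H

-- TODO item stmt-SmoothPoincare4-0368 · crux · rank 4 · open · by planner — BLOCKED: missing decl(s) Literature.Topology.FourManifolds.SphereEmbedding.HasRasmussenInvariant; restate via `ledger route edit` once they land: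
--   def ZseSVanishesOnPairs : Prop := ∀ (K K' : Literature.Topology.FourManifolds.Knot) (Y : Type) [TopologicalSpace Y] [ChartedSpace (EuclideanSpace ℝ (Fin 3)) Y] (s : ℤ), Literature.Topology.FourManifolds.IsIntegralSurgery (𝓡 3) Y K 0 → Literature.Topology.FourManifolds.IsIntegralSurgery (𝓡 3) Y K' 0 → K.IsSmoothlySlice → K'.HasRasmus

/-- item stmt-SmoothPoincare4-0520 · support · rank 5 · open · by planner
why it might fail: SPC4 implies its negation (Palais/Cerf: Sigma = S4 => Sigma minus a ball = B4); every non-Khovanov slice obstruction applies equally in homotopy balls (arXiv:2601.05425 p.24), so a witness needs s-type invariants whose homotopy-ball behaviour is open (MMSW Q9.11).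
sources: FreedmanGompfMorrisonWalker2010, §1, ManolescuPiccirillo2023, §1, arXiv:2601.05425, §7 p.24, tree: Literature.Topology.FourManifolds.Knot.exists_exotic_of_isHomotopyBallSlice_not_isSmoothlySlice (HomotopyBallSlice.lean)
∃ K : Literature.Topology.FourManifolds.Knot, K.IsHomotopyBallSlice ∧ ¬ K.IsSmoothlySlice. The
Freedman–Gompf–Morrison–Walker / Manolescu–Piccirillo target one level above the thesis: thesis 0364
⇒ this (via fact_MP_v2; = assembly v2 (b), provable now) and this ⇒ ¬SmoothPoincare4 (via the
in-file named fact
Literature.Topology.FourManifolds.Knot.exists_exotic_of_isHomotopyBallSlice_not_isSmoothlySlice; =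
assembly v2 (a), provable now). STATUS: OPEN. SPC4 ⇒ ¬(this) (Palais: Σ ≅ S⁴ ⇒ Σ ∖ B̊⁴ ≅ B⁴), so
refuting it does not decide SPC4 but closes routes R1 and every 'H-slice in homotopy ball' strategy
(FGMW 2010, MP 2023, Nakamura2023's obstruction shows the s-invariant cannot certify ¬slice here for
MP's 5 pairs — cf. kill test 0368). Certified-computation angle unchanged: candidates come from
0-surgery pairs / RBG links (ManolescuPiccirillo2023 §§3–5) with sliceness obstructions that survive
homotopy balls NOT allowed (any obstruction used for ¬IsSmoothlySlice must be a B⁴-obstruction that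
is not a homotopy-ball obstruction: s, τ, ε, ν⁺ all extend to homotopy balls by
FGMW/MMSW/Ren–Willis-type arguments? — s does (ManolescuMarengonSarkarWillis2023 / RenWillis2024),
which is exactly w -/
@[route_item "route-SmoothPoincare4-ZeroSurgeryExotic", crux]
def ZseHsliceNotSlice : Prop :=
  ∃ K : Literature.Topology.FourManifolds.Knot, K.IsHomotopyBallSlice ∧ ¬ K.IsSmoothlySlice

/-- item stmt-SmoothPoincare4-0365 · assembly · rank 1 · closed · proved by Summit.SmoothPoincare4.SmoothPoincare4.Theorems.assembly_proof @ 28bdf8865488 (prover) · by planner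
K slice ⇒ 0-trace X₀(K) ↪ S⁴; V := S⁴ ∖ int X₀(K) has ∂V ≅ S³_0(K) ≅ S³_0(K'); Z := X₀(K') ∪ V is a
closed smooth homotopy 4-sphere in which K' bounds the 2-handle core disc inside the homotopy ball Z
∖ int B⁴; SPC4 ⇒ Z ≅ S⁴ ⇒ Z ∖ int B⁴ ≅ B⁴ (Palais1960/Cerf1968 disc theorem) ⇒ K' slice,
contradiction. Sources: ManolescuPiccirillo2023 Thm 1.1/§1; Palais1960; Cerf1968. [elaboration note
2026-08-13: depends on Literature.Topology.FourManifolds.Knots whose .olean is missing at HEAD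
(Knots.lean has 3 proofs broken by the M5 demotion of
IsAmbientIsotopic.symm/trans/isSmoothlyIsotopic to Props); signature elaborated against a locally
patched overlay build — re-run `lean check` once Knots is rebuilt.] -/
@[route_item "route-SmoothPoincare4-ZeroSurgeryExotic", crux]
def Assembly : Prop :=
  (∃ (K K' : Literature.Topology.FourManifolds.Knot) (Y : Type) (_ : TopologicalSpace Y) (_ : ChartedSpace (EuclideanSpace ℝ (Fin 3)) Y), Literature.Topology.FourManifolds.IsIntegralSurgery (𝓡 3) Y K 0 ∧ Literature.Topology.FourManifolds.IsIntegralSurgery (𝓡 3) Y K' 0 ∧ K.IsSmoothlySlice ∧ ¬ K'.IsSmoothlySlice) → ¬ SmoothPoincare4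

-- `Assembly` holds: proved by `Summit.SmoothPoincare4.SmoothPoincare4.Theorems.assembly_proof` @ 28bdf8865488 (its module imports this route file, so no `_holds` link can be stated here).

-- records of items no longer active in this route (dropped / restated):
-- earlier Assembly2 (stmt-SmoothPoincare4-0367, dropped 2026-08-16T14:15:59Z): moot by None — ∀ (K K' : Literature.Topology.FourManifolds.Knot) (Y : Type) [TopologicalSpace Y] [ChartedSpace (EuclideanSpace ℝ (Fin 3)) Y], Literature.Topology.FourManifolds.IsIntegralSurgery (𝓡 3) Y K 0 → Literature.Topology.FourManifolds.IsIntegralSurgery (𝓡 3) Y K' 0 → K.IsSmoothlySlice → K'.IsSmoothlySlice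
-- earlier Assembly3 (stmt-SmoothPoincare4-0521, dropped 2026-08-16T14:15:59Z): proved by Summit.SmoothPoincare4.SmoothPoincare4.Theorems.zeroSurgeryExotic_assembly3_proof — Literature.Topology.FourManifolds.Knot.exists_exotic_of_isHomotopyBallSlice_not_isSmoothlySlice → (∃ K : Literature.Topology.FourManifolds.Knot, K.IsHomotopyBallSlice ∧ ¬ K.IsSmoothlySlice) → ¬ SmoothPoincare4
-- earlier Assembly4 (stmt-SmoothPoincare4-0522, dropped 2026-08-16T14:15:59Z): proved by Summit.SmoothPoincare4.SmoothPoincare4.Theorems.Assembly4_proof @ b9d750984767 — (∀ (K K' : Literature.Topology.FourManifolds.Knot) (Y : Type) [TopologicalSpace Y] [ChartedSpace (EuclideanSpace ℝ (Fin 3)) Y], Literature.Topology.FourManifolds.IsIntegralSurgery (𝓡 3) Y K 0 → Literature.Topology.FourManifolds.IsIn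

/-! D-0027 §2.1 — DECIDING THEOREM (planner-authored via `route open/edit --closes-file`; by planner-rbadge-SmoothPoincare4-ZeroSurgeryExot-182dc12c-g4-0 2026-08-15T16:23:16Z):
its hypotheses are this route's items and its conclusion the sub-problem Statement (glue_lint), and it elaborates with this file. -/

@[closes "route-SmoothPoincare4-ZeroSurgeryExotic"] theorem closes (hX : ZseThesis) (hA : Assembly) : ¬ _root_.SmoothPoincare4 := hA hX

end Summit.SmoothPoincare4.SmoothPoincare4.Theses.ZeroSurgeryExotic
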